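import Literature.AlgebraicGeometry.Resolution.AlterationsSectionDivisor
import Literature.AlgebraicGeometry.Resolution.AdicQuotient
import Literature.AlgebraicGeometry.Motives.FiberStalk
import Mathlib.AlgebraicGeometry.AlgClosed.Basic
import HarnessLib

/-!
# De Jong's alteration theorem: the local data at a closed node of the curve of Situation 4.23
# (the hypotheses of de Jong 1996, 2.23 / Liu 2002, Lemma 10.3.20 for `𝒪_{Y,f x} → 𝒪_{X,x}`)

Topic: `Literature/AlgebraicGeometry/Resolution`. De Jong 1996, 2.23 ("Local description of (split)
semi-stable curves") computes the complete local ring of a semi-stable curve `f : X → S` at a point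
`x ∈ Sing(f)` over `s` from three inputs: `B = 𝒪_{X,x}` is FLAT over `A = 𝒪_{S,s}`; in the split
case the residue fields agree ("If `f` is a split semi-stable curve, then `k = A'`"; 4.24: over an
algebraically closed field "we consider only closed points, so that the situation is
automatically split"); and "by assumption of semi-stability we have that
`B/𝔪_A B ≅ k'⟦u, v⟧/(q)` … we may choose `q = uv`". The commutative algebra turning these into
`B̂ ≅ Â⟦u, v⟧/(uv - h)` is Liu 2002, Lemma 10.3.20 (`NodalDeformation.lean`:
`NodalDeformation.exists_ringEquiv_cpl`, whose hypotheses are exactly the three statements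
below). This file PROVES the three inputs for the curve `f : X → Y` of a pair in Situation 4.23
(`DeJong1996.SemiStablePair f g D τ`, `AlterationsSemiStable.lean`) over an algebraically closed
field `k`, at a closed point `x` at which the fibre `X_{f x}` is singular:

* `residueFieldMap_surjective_of_isClosed` — for `f : X → Y` over `k` (both locally of finite
  type) and closed points `x ↦ f x`, `κ(f x) → κ(x)` is onto (both are `k`, compatibly:
  Mathlib's `residueFieldIsoBase` and `Spec.map_inj`); hence
  `DeJong1996.SemiStablePair.residue_comp_stalkMap_surjective`: `𝒪_{Y,f x} → 𝒪_{X,x} → κ(x)`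
  is onto.
* `DeJong1996.SemiStablePair.stalkMap_flat` — `𝒪_{Y,f x} → 𝒪_{X,x}` is flat (2.21: `f` is
  flat; Mathlib's `Flat.stalkMap`).
* `DeJong1996.SemiStablePair.nonempty_ringEquiv_fibreCompletion` — the completion of the closed
  fibre `𝒪_{X,x}/𝔪_{f x} 𝒪_{X,x}` (taken at the image of `𝔪_x`, the shape of
  `quotientCompletionEquiv`) is `κ(f x)⟦u, v⟧/(uv)`: the fibre `X_{f x}` is a geometric fibre
  (`κ(f x) = k` is algebraically closed), so by 2.21 its closed point `x` is a nonsingular point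
  of a curve or an ordinary double point (`IsOrdinaryDoublePoint`), the former being excluded;
  and `𝒪_{X_{f x}, x} ≅ 𝒪_{X,x}/𝔪_{f x} 𝒪_{X,x}`
  (`Literature.AlgebraicGeometry.Motives.nonempty_stalkFiber_ringEquiv_asFiber`), transported to
  the completions (`adicCompletionCongr`).

## Sources

* A. J. de Jong, *Smoothness, semi-stability and alterations*, Publ. Math. IHÉS 83 (1996), 2.21,
  2.23 (pp. 61–62), 4.24 (p. 75).
* Q. Liu, *Algebraic Geometry and Arithmetic Curves* (2002), Lemma 10.3.20 and the proof of
  Cor. 10.3.22 ("we have isomorphisms `𝒪̂_{X',x'}/(t') ≅ 𝒪̂_{X'_{s'},x'} ≅ k(s)⟦u, v⟧/(uv)`. Lemma 3.20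
  then implies isomorphism (3.26)").
-/

noncomputable section

open CategoryTheory CategoryTheory.Limits AlgebraicGeometry TopologicalSpace IsLocalRing

namespace Literature.AlgebraicGeometry.Resolution

universe u

/-! ## Residue fields at closed points over an algebraically closed field -/

/-- **Closed points over an algebraically closed field have the same residue field, compatibly**:
for `f : X → Y` over `Spec k` with `X`, `Y` locally of finite type and closed points `x`,
`f x`, the map `κ(f x) → κ(x)` is onto. (Both structure maps `k → κ(x)`, `k → κ(f x)` are
isomorphisms, `residueFieldIsoBase`, and `k → κ(f x) → κ(x)` is the structure map of `κ(x)`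
because the two agree after `Spec`, `Spec.map_inj`.) [folklore] -/
theorem residueFieldMap_surjective_of_isClosed {k : Type u} [Field k] [IsAlgClosed k]
    {X Y : Scheme.{u}} (f : X ⟶ Y) (g : Y ⟶ Spec (.of k)) [LocallyOfFiniteType g]
    [LocallyOfFiniteType (f ≫ g)] {x : X} (hx : IsClosed ({x} : Set X))
    (hy : IsClosed ({f x} : Set Y)) : Function.Surjective (f.residueFieldMap x).hom := by
  let θx := (residueFieldIsoBase (f ≫ g) x hx).inv
  let θy := (residueFieldIsoBase g (f x) hy).inv
  have hθ : θx = θy ≫ f.residueFieldMap x := by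
    rw [← Spec.map_inj, Spec.map_comp, SpecMap_residueFieldIsoBase_inv,
      SpecMap_residueFieldIsoBase_inv]
    simp only [← Category.assoc, Scheme.Hom.SpecMap_residueFieldMap_fromSpecResidueField]
  intro r
  obtain ⟨c, hc⟩ := (residueFieldIsoBase (f ≫ g) x hx).symm.commRingCatIsoToRingEquiv.surjective r
  refine ⟨θy.hom c, ?_⟩
  rw [← hc]
  change (θy ≫ f.residueFieldMap x).hom c = θx.hom c
  rw [hθ]

namespace DeJong1996.SemiStablePair

variable {k : Type u} [Field k] {X Y : Scheme.{u}} {f : X ⟶ Y} {g : Y ⟶ Spec (.of k)}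
  {D : Set Y} {n : ℕ} {τ : Fin n → (Y ⟶ X)}

/-- In Situation 4.23, the image of a closed point of `X` is a closed point of `Y` (`f` is
proper). [folklore] -/
theorem isClosed_image (hS : SemiStablePair f g D τ) {x : X} (hx : IsClosed ({x} : Set X)) :
    IsClosed ({f x} : Set Y) := by
  haveI := hS.isSemiStableCurve.isProper
  rw [← Set.image_singleton]
  exact f.isClosedMap _ hx

/-- **Split node, first input — the residue fields agree**: in Situation 4.23 over an
algebraically closed field, at a closed point `x`, the composite `𝒪_{Y,f x} → 𝒪_{X,x} → κ(x)` is
onto (de Jong 1996, 4.24: "there we consider only closed points, so that the situation is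
automatically split"). [cite: DeJong1996, 2.23 and 4.24, pp. 61–62, 75] -/
theorem residue_comp_stalkMap_surjective [IsAlgClosed k] (hS : SemiStablePair f g D τ) {x : X}
    (hx : IsClosed ({x} : Set X)) :
    Function.Surjective ((residue (X.presheaf.stalk x)).comp (f.stalkMap x).hom) := by
  haveI := hS.locallyOfFiniteType
  haveI : IsProper g :=
    Literature.AlgebraicGeometry.Motives.IsProjectiveOver.isProper (X := Over.mk g)
      hS.isProjectiveOver_base
  have hsurj := residueFieldMap_surjective_of_isClosed f g hx (hS.isClosed_image hx)
  intro r
  obtain ⟨r', hr'⟩ := hsurj r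
  obtain ⟨a, rfl⟩ := residue_surjective r'
  refine ⟨a, ?_⟩
  rw [← hr', RingHom.comp_apply]
  exact (ResidueField.map_residue (f.stalkMap x).hom a).symm

/-- **Split node, second input — flatness**: `𝒪_{Y,f x} → 𝒪_{X,x}` is flat (2.21: a semi-stable
curve is flat). [cite: DeJong1996, 2.21, p. 61] -/
theorem stalkMap_flat (hS : SemiStablePair f g D τ) (x : X) : (f.stalkMap x).hom.Flat :=
  haveI := hS.isSemiStableCurve.flat
  Flat.stalkMap f x

/-- The maximal ideal of a proper quotient of a local ring is the image of the maximal ideal.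
[folklore] -/
theorem map_mk_maximalIdeal_eq {R : Type*} [CommRing R] [IsLocalRing R] (J : Ideal R)
    [IsLocalRing (R ⧸ J)] :
    (maximalIdeal R).map (Ideal.Quotient.mk J) = maximalIdeal (R ⧸ J) := by
  haveI : IsLocalHom (Ideal.Quotient.mk J) :=
    IsLocalHom.of_surjective _ Ideal.Quotient.mk_surjective
  apply le_antisymm (((local_hom_TFAE (Ideal.Quotient.mk J)).out 0 2).mp ‹_›)
  intro z hz
  obtain ⟨b, rfl⟩ := Ideal.Quotient.mk_surjective z
  refine Ideal.mem_map_of_mem _ ((mem_maximalIdeal b).mpr fun hb => ?_)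
  exact (mem_maximalIdeal _).mp hz (hb.map _)

/-- At a closed point of `X` in Situation 4.23 over an algebraically closed field, the fibre
`X_{f x}` is regular or has an ordinary double point at `x` (2.21 for the geometric fibre over
the closed point `f x`, whose residue field is `k`). [cite: DeJong1996, 2.21, p. 61] -/
theorem isRegularLocalRing_or_isOrdinaryDoublePoint_asFiber [IsAlgClosed k]
    (hS : SemiStablePair f g D τ) {x : X} (hx : IsClosed ({x} : Set X)) :
    (IsRegularLocalRing ((f.fiber (f x)).presheaf.stalk (f.asFiber x)) ∧
        ringKrullDim ((f.fiber (f x)).presheaf.stalk (f.asFiber x)) = 1) ∨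
      IsOrdinaryDoublePoint (Y.residueField (f x)) (f.asFiber x) := by
  have hy := hS.isClosed_image hx
  haveI : IsProper g :=
    Literature.AlgebraicGeometry.Motives.IsProjectiveOver.isProper (X := Over.mk g)
      hS.isProjectiveOver_base
  haveI : IsAlgClosed (Y.residueField (f x)) :=
    IsAlgClosed.of_ringEquiv k _ (residueFieldIsoBase g (f x) hy).commRingCatIsoToRingEquiv.symm
  -- the point of the fibre over `x` is closed
  have hx' : IsClosed ({f.asFiber x} : Set ↥(f.fiber (f x))) := by
    have e : ({f.asFiber x} : Set ↥(f.fiber (f x))) = f.fiberι (f x) ⁻¹' {x} := by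
      ext z
      simp only [Set.mem_singleton_iff, Set.mem_preimage]
      constructor
      · rintro rfl
        exact f.fiberι_asFiber x
      · intro hz
        apply (f.fiberι (f x)).isEmbedding.injective
        rw [hz, f.fiberι_asFiber]
    rw [e]
    exact hx.preimage (f.fiberι (f x)).continuous
  exact hS.isSemiStableCurve.isRegularLocalRing_or_isOrdinaryDoublePoint (Y.residueField (f x))
    (Y.fromSpecResidueField (f x)) (f.asFiber x) hx'

/-- **Split node, third input — the closed fibre is a formal node.** In Situation 4.23 over an
algebraically closed field, at a closed point `x` at which the fibre `X_{f x}` is singular, the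
completion of `𝒪_{X,x}/𝔪_{f x} 𝒪_{X,x}` (at the image of `𝔪_x`) is isomorphic to
`κ(f x)⟦u, v⟧/(uv)`: "By assumption of semi-stability we have that `B/𝔪_A B ≅ k'⟦u, v⟧/(q)` … we
may choose `q = uv`" (2.23; 2.21 for the geometric fibre `X_{f x}`, `x` not being a nonsingular
point of it, and `𝒪_{X_{f x}, x} ≅ 𝒪_{X,x}/𝔪_{f x} 𝒪_{X,x}`).
[cite: DeJong1996, 2.23, pp. 61–62] -/
theorem nonempty_ringEquiv_fibreCompletion [IsAlgClosed k] (hS : SemiStablePair f g D τ) {x : X}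
    (hx : IsClosed ({x} : Set X))
    (hsing : ¬ IsRegularLocalRing ((f.fiber (f x)).presheaf.stalk (f.asFiber x))) :
    Nonempty (AdicCompletion
        ((maximalIdeal (X.presheaf.stalk x)).map (Ideal.Quotient.mk
          ((maximalIdeal (Y.presheaf.stalk (f x))).map (f.stalkMap x).hom)))
        (X.presheaf.stalk x ⧸ (maximalIdeal (Y.presheaf.stalk (f x))).map (f.stalkMap x).hom) ≃+*
      (MvPowerSeries (Fin 2) (ResidueField (Y.presheaf.stalk (f x))) ⧸
        Ideal.span {(MvPowerSeries.X 0 * MvPowerSeries.X 1 :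
          MvPowerSeries (Fin 2) (ResidueField (Y.presheaf.stalk (f x))))})) := by
  rcases hS.isRegularLocalRing_or_isOrdinaryDoublePoint_asFiber hx with ⟨hreg, -⟩ | ⟨⟨e⟩⟩
  · exact absurd hreg hsing
  -- `𝒪_{X_{f x}, x} ≅ 𝒪_{X,x}/𝔪_{f x} 𝒪_{X,x}`
  set J : Ideal (X.presheaf.stalk x) :=
    (maximalIdeal (Y.presheaf.stalk (f x))).map (f.stalkMap x).hom with hJ
  obtain ⟨e₀⟩ := Literature.AlgebraicGeometry.Motives.nonempty_stalkFiber_ringEquiv_asFiber f x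
  have hloc : IsLocalHom (f.stalkMap x).hom := inferInstance
  have hJle : J ≤ maximalIdeal (X.presheaf.stalk x) :=
    ((local_hom_TFAE (f.stalkMap x).hom).out 0 2).mp hloc
  haveI : Nontrivial (X.presheaf.stalk x ⧸ J) :=
    Ideal.Quotient.nontrivial_iff.mpr fun h =>
      (maximalIdeal.isMaximal _).ne_top (top_le_iff.mp (h ▸ hJle))
  haveI : IsLocalRing (X.presheaf.stalk x ⧸ J) :=
    IsLocalRing.of_surjective' (Ideal.Quotient.mk J) Ideal.Quotient.mk_surjective
  have hmax : (maximalIdeal ((f.fiber (f x)).presheaf.stalk (f.asFiber x))).map e₀.toRingHom =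
      (maximalIdeal (X.presheaf.stalk x)).map (Ideal.Quotient.mk J) := by
    rw [map_mk_maximalIdeal_eq]
    exact map_ringEquiv_maximalIdeal e₀
  exact ⟨(adicCompletionCongr _ _ e₀ hmax).symm.trans e⟩

end DeJong1996.SemiStablePair

end Literature.AlgebraicGeometry.Resolution

end
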